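import Literature.NumberTheory.Transcendental.BrownZagierCoefficients
import Literature.NumberTheory.Transcendental.BrownMixedTateLemmas
import Literature.NumberTheory.Transcendental.MultipleZetaRepeatedTwosProofs
import HarnessLib

/-!
# Brown, *Mixed Tate motives over ℤ* (2012) — Theorem 7.3 in level one, for real numbers:
# the Zagier matrix is invertible, hence (given Zagier's theorem) `ζ(2n+1) ∈ hoffmanSpan (2n+1)`

Sibling proof file in the cone of the named fact
`Literature.NumberTheory.Transcendental.hoffmanSpan_eq_mzvSpace` (Brown 2012, Theorem 1.1). The
level-one case of Brown's argument is elementary once Zagier's evaluation (Theorem 4.1) is given,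
and we carry it out for real multiple zeta values. In weight `2n + 1` the `n` Hoffman elements of
level one are `ζ(2^{a} 3 2^{b})`, `a + b + 1 = n`, and Zagier's theorem reads (rows `b`, columns
`r = j + 1`)

`ζ(2^{n-1-b} 3 2^{b}) = ∑_{j < n} Z⁽ⁿ⁾_{b,j} · ζ(2j+3) ζ({2}^{n-1-j})`,
`Z⁽ⁿ⁾_{b,j} = 2 (-1)^{j+1} (A^{j+1}_{n-1-b,b} - B^{j+1}_{n-1-b,b})`

(`Brown2012.zagierMatrix n`). We PROVE:

* `Brown2012.isUnit_zagierMatrix` — **the matrix `Z⁽ⁿ⁾` is invertible** (Brown 2012, Theorem 7.3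
  for `ℓ = 1`): by the `2`-adic Lemma 7.1 (`Brown2012.lemma_7_1`, file `BrownMixedTateLemmas`):
  below the diagonal (`b > j`) `B^{j+1}_{·,b} = 0` and the entries are even integers
  (Corollary 6.2: "upper-triangular modulo `I`", `μ(I) ⊆ 2ℤ`); on and above it
  `Z⁽ⁿ⁾_{b,j} ≡ c_{2^{j-b} 3 2^{b}}` modulo `2ℤ`, so that by Corollary 4.4 (2)
  (`padicValRat_zagierCoeff_three_twos_le`, `…_le_zero`, file `BrownZagierCoefficients`) the
  diagonal entry `c_{3 2^{j}}` has the least `2`-adic valuation of its column, and it is `≤ 0`;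
* `Brown2012.mem_of_isUnit_of_eq_sum_smul` — linear algebra: if `H = Z • P` with `Z` invertible
  over `ℚ` and all `H_b` in a `ℚ`-subspace `S ⊆ ℝ`, then all `P_j ∈ S`;
* `multipleZeta_odd_mul_twos_mem_hoffmanSpan_of_zagier` — **given Zagier's Theorem 4.1 in weight
  `2n+1`** (as an explicit hypothesis: the `n` real identities above, proved in this tree for
  `n ≤ 4` in `BrownZagierFormulaLowWeightProofs`, in general Zagier, Ann. of Math. 175 (2012)),
  every `ζ(2j+3) ζ({2}^{n-1-j})`, `j < n`, lies in `hoffmanSpan (2n+1)`; in particular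
  (`multipleZeta_odd_mem_hoffmanSpan_of_zagier`) **`ζ(2n+1) ∈ hoffmanSpan (2n+1)`** — Brown's
  Theorem 1.1 for the depth-one values of odd weight, reduced to Zagier's theorem exactly as in
  Brown's proof (Theorems 7.3–7.4 at level one), with no motivic input.

Conventions as in `BrownZagierCoefficients`: Brown's `ζ(2^{a} 3 2^{b})` is
`multipleZeta (List.replicate b 2 ++ 3 :: List.replicate a 2)`.

## References

* F. Brown, *Mixed Tate motives over ℤ*, Ann. of Math. **175** (2012), 949–976: Theorem 4.1,
  Corollary 4.4, Corollary 6.2, Lemma 7.1, Theorems 7.3, 7.4 (arXiv:1102.1312). [Brown2012]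
* D. Zagier, *Evaluation of the multiple zeta values `ζ(2,…,2,3,2,…,2)`*, Ann. of Math. **175**
  (2012), 977–1000, Theorem 1. [Zagier2012]
-/

noncomputable section

open scoped BigOperators Nat
open Real

namespace Literature.NumberTheory.Transcendental

namespace Brown2012

/-- **The Zagier matrix of weight `2n+1`** (level one of Brown's `M_{N,1}`, `N = 2n+1`):
`Z⁽ⁿ⁾_{b,j} = 2 (-1)^{j+1} (A^{j+1}_{n-1-b,b} - B^{j+1}_{n-1-b,b})`, the coefficient of
`ζ(2j+3) ζ({2}^{n-1-j})` in Zagier's formula for `ζ(2^{n-1-b} 3 2^{b})` (rows: the position `b`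
of the letter `3`; columns: `r - 1 = j`). [cite: Brown2012, Theorem 4.1 and §6 (6.2)] -/
def zagierMatrix (n : ℕ) : Matrix (Fin n) (Fin n) ℚ :=
  Matrix.of fun b j => 2 * (-1) ^ ((j : ℕ) + 1) * (zagierA (j + 1) (n - 1 - b) - zagierB (j + 1) b)

/-- Unfolding `zagierMatrix`. [folklore] -/
theorem zagierMatrix_apply (n : ℕ) (b j : Fin n) : zagierMatrix n b j =
    2 * (-1) ^ ((j : ℕ) + 1) * (zagierA (j + 1) (n - 1 - b) - zagierB (j + 1) b) := rfl

/-! ### `2`-adic structure of the Zagier matrix (Brown 2012, Corollary 6.2 and Theorem 7.3, level 1) -/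

/-- Below the diagonal `B^{j+1}_{·,b} = 0` (`b > j`: `C(2j+2, 2b+1) = 0`), so the entry is the even
integer `2 (-1)^{j+1} C(2j+2, 2(n-1-b)+2)` ("upper-triangular modulo `I`", `μ(I) ⊆ 2ℤ`).
[cite: Brown2012, Corollary 6.2] -/
theorem zagierMatrix_below (n : ℕ) (b j : Fin n) (h : (j : ℕ) < b) :
    zagierMatrix n b j = 2 * ((-1) ^ ((j : ℕ) + 1) * (Nat.choose (2 * (j + 1)) (2 * (n - 1 - b) + 2) : ℤ) : ℤ) := by
  rw [zagierMatrix_apply, zagierB_def, Nat.choose_eq_zero_of_lt (by omega), zagierA_def]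
  push_cast
  ring

/-- On and above the diagonal (`b ≤ j`) the entry is `c_{2^{j-b} 3 2^{b}}` plus an even integer:
`Z⁽ⁿ⁾_{b,j} = c_{2^{j-b} 3 2^{b}} + 2 (-1)^{j+1} (C(2j+2, 2(n-1-b)+2) - C(2j+2, 2(j-b)+2))`.
[cite: Brown2012, Corollary 6.2 and Theorem 7.3] -/
theorem zagierMatrix_above (n : ℕ) (b j : Fin n) (h : (b : ℕ) ≤ j) :
    zagierMatrix n b j = zagierCoeff (j - b) b +
      2 * ((-1) ^ ((j : ℕ) + 1) * ((Nat.choose (2 * (j + 1)) (2 * (n - 1 - b) + 2) : ℤ) -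
        Nat.choose (2 * (j + 1)) (2 * (j - b) + 2)) : ℤ) := by
  rw [zagierMatrix_apply, zagierCoeff_def, show (j : ℕ) - b + b + 1 = j + 1 by omega, zagierA_def,
    zagierA_def]
  push_cast
  ring

/-- Adding an even integer to a rational of non-positive `2`-adic valuation changes neither its
non-vanishing nor its valuation (ultrametric inequality). [folklore] -/
theorem padicValRat_add_two_mul_int {c : ℚ} (z : ℤ) (hc : c ≠ 0) (hv : padicValRat 2 c ≤ 0) :
    c + 2 * (z : ℚ) ≠ 0 ∧ padicValRat 2 (c + 2 * (z : ℚ)) = padicValRat 2 c := by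
  by_cases hz : z = 0
  · subst hz; simp [hc]
  · have hX0 : (2 * (z : ℚ)) ≠ 0 := mul_ne_zero two_ne_zero (by exact_mod_cast hz)
    have hvX : 1 ≤ padicValRat 2 (2 * (z : ℚ)) := by
      rw [padicValRat.mul two_ne_zero (by exact_mod_cast hz),
        show padicValRat 2 (2 : ℚ) = 1 from padicValRat.self one_lt_two, padicValRat.of_int]
      have : 0 ≤ padicValInt 2 z := by rw [padicValInt]; positivity
      omega
    have hlt : padicValRat 2 c < padicValRat 2 (2 * (z : ℚ)) := by omega
    have hsum : c + 2 * (z : ℚ) ≠ 0 := by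
      intro h0
      have hcz : c = -(2 * (z : ℚ)) := by linear_combination h0
      rw [hcz, padicValRat.neg] at hlt
      exact lt_irrefl _ hlt
    exact ⟨hsum, padicValRat.add_eq_of_lt hsum hc hX0 hlt⟩

/-- The valuation of the entries on and above the diagonal: for `b ≤ j`,
`Z⁽ⁿ⁾_{b,j} ≠ 0` and `v₂(Z⁽ⁿ⁾_{b,j}) = v₂(c_{2^{j-b} 3 2^{b}})`. [cite: Brown2012, Theorem 7.3] -/
theorem padicValRat_zagierMatrix_above (n : ℕ) (b j : Fin n) (h : (b : ℕ) ≤ j) :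
    zagierMatrix n b j ≠ 0 ∧
      padicValRat 2 (zagierMatrix n b j) = padicValRat 2 (zagierCoeff (j - b) b) := by
  rw [zagierMatrix_above n b j h]
  exact padicValRat_add_two_mul_int _ (zagierCoeff_ne_zero _ _) (padicValRat_zagierCoeff_le_zero _ _)

/-- **Brown 2012, Theorem 7.3 for level one (real form): the Zagier matrix `Z⁽ⁿ⁾` is invertible.**
It satisfies the hypotheses of the `2`-adic Lemma 7.1: (i) below the diagonal its entries are even
integers; (ii) in the column `j` the diagonal entry, of valuation `v₂(c_{3 2^{j}}) ≤ 0`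
(Corollary 4.4 (2)), has the least valuation. [cite: Brown2012, Theorem 7.3] -/
theorem isUnit_zagierMatrix (n : ℕ) : IsUnit (zagierMatrix n) := by
  refine lemma_7_1 2 (zagierMatrix n) (fun i j hij => ?_) (fun i j => ?_) (fun j => ?_)
  · -- (i) below the diagonal: even integers
    have hij' : (j : ℕ) < i := hij
    rw [zagierMatrix_below n i j hij']
    set z : ℤ := (-1) ^ ((j : ℕ) + 1) * (Nat.choose (2 * (j + 1)) (2 * (n - 1 - i) + 2) : ℤ) with hz
    by_cases hz0 : z = 0
    · left; rw [hz0]; simp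
    · right
      rw [padicValRat.mul two_ne_zero (by exact_mod_cast hz0),
        show padicValRat 2 (2 : ℚ) = 1 from padicValRat.self one_lt_two, padicValRat.of_int]
      have : 0 ≤ padicValInt 2 z := by rw [padicValInt]; positivity
      omega
  · -- (ii) the diagonal entry has the least valuation in its column
    rcases lt_or_ge (j : ℕ) i with hlt | hle
    · -- below the diagonal: zero, or valuation ≥ 1 > 0 ≥ v(diagonal)
      rw [zagierMatrix_below n i j hlt]
      set z : ℤ := (-1) ^ ((j : ℕ) + 1) * (Nat.choose (2 * (j + 1)) (2 * (n - 1 - i) + 2) : ℤ) with hz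
      by_cases hz0 : z = 0
      · left; rw [hz0]; simp
      · right
        have hd := padicValRat_zagierMatrix_above n j j le_rfl
        rw [hd.2, padicValRat.mul two_ne_zero (by exact_mod_cast hz0),
          show padicValRat 2 (2 : ℚ) = 1 from padicValRat.self one_lt_two, padicValRat.of_int]
        have h1 : 0 ≤ padicValInt 2 z := by rw [padicValInt]; positivity
        have h2 := padicValRat_zagierCoeff_le_zero ((j : ℕ) - j) j
        omega
    · right
      rw [(padicValRat_zagierMatrix_above n j j le_rfl).2, (padicValRat_zagierMatrix_above n i j hle).2,
        Nat.sub_self]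
      have h := padicValRat_zagierCoeff_three_twos_le ((j : ℕ) - i) i
      rwa [show (j : ℕ) - i + i = j by omega] at h
  · -- the diagonal entries: `≠ 0`, valuation `≤ 0`
    have hd := padicValRat_zagierMatrix_above n j j le_rfl
    refine ⟨hd.1, ?_⟩
    rw [hd.2]
    exact padicValRat_zagierCoeff_le_zero _ _

/-- `det Z⁽ⁿ⁾ ≠ 0`. [cite: Brown2012, Theorem 7.3] -/
theorem det_zagierMatrix_ne_zero (n : ℕ) : (zagierMatrix n).det ≠ 0 := by
  have h := isUnit_zagierMatrix n
  rw [Matrix.isUnit_iff_isUnit_det, isUnit_iff_ne_zero] at h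
  exact h

/-! ### Linear algebra: inverting an invertible rational system inside a `ℚ`-subspace of `ℝ` -/

/-- If `H_b = ∑_j Z_{b,j} • P_j` for an invertible rational matrix `Z` and all `H_b` lie in a
`ℚ`-subspace `S ⊆ ℝ`, then all `P_j` lie in `S` (`P = Z⁻¹ H`). [folklore] -/
theorem mem_of_isUnit_of_eq_sum_smul {ι : Type*} [Fintype ι] [DecidableEq ι] (Z : Matrix ι ι ℚ)
    (hZ : IsUnit Z) (S : Submodule ℚ ℝ) (P H : ι → ℝ) (hH : ∀ b, H b = ∑ j, Z b j • P j)
    (hS : ∀ b, H b ∈ S) (k : ι) : P k ∈ S := by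
  have hdet : IsUnit Z.det := (Matrix.isUnit_iff_isUnit_det Z).1 hZ
  have hinv : Z⁻¹ * Z = 1 := Matrix.nonsing_inv_mul Z hdet
  have key : P k = ∑ b, Z⁻¹ k b • H b := by
    calc P k = ∑ j, (1 : Matrix ι ι ℚ) k j • P j := by
          rw [Finset.sum_eq_single k]
          · simp
          · intro j _ hjk; simp [Ne.symm hjk]
          · intro hk; exact absurd (Finset.mem_univ k) hk
      _ = ∑ j, (∑ b, Z⁻¹ k b * Z b j) • P j := by
          refine Finset.sum_congr rfl fun j _ => ?_
          rw [← hinv, Matrix.mul_apply]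
      _ = ∑ j, ∑ b, (Z⁻¹ k b * Z b j) • P j := by
          refine Finset.sum_congr rfl fun j _ => ?_
          rw [Finset.sum_smul]
      _ = ∑ b, ∑ j, (Z⁻¹ k b * Z b j) • P j := Finset.sum_comm
      _ = ∑ b, Z⁻¹ k b • H b := by
          refine Finset.sum_congr rfl fun b _ => ?_
          rw [hH b, Finset.smul_sum]
          refine Finset.sum_congr rfl fun j _ => ?_
          rw [mul_smul]
  rw [key]
  exact Submodule.sum_mem _ fun b _ => Submodule.smul_mem _ _ (hS b)

end Brown2012

open Brown2012 MZV

/-! ### Consequence: given Zagier's theorem, `ζ(2n+1) ∈ hoffmanSpan (2n+1)` -/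

/-- The words `2^{b} 3 2^{a}` (Zagier convention) are Hoffman words of weight `2(a+b)+3`.
[folklore] -/
theorem isHoffman_twos_three_twos (a b : ℕ) :
    IsHoffman (List.replicate b 2 ++ 3 :: List.replicate a 2) := by
  intro i hi
  simp only [List.mem_append, List.mem_cons] at hi
  rcases hi with h | h | h
  · exact Or.inl (List.eq_of_mem_replicate h)
  · exact Or.inr h
  · exact Or.inl (List.eq_of_mem_replicate h)

/-- `weight (2^{b} 3 2^{a}) = 2(a+b) + 3`. [folklore] -/
theorem weight_twos_three_twos (a b : ℕ) :
    weight (List.replicate b 2 ++ 3 :: List.replicate a 2) = 2 * (a + b) + 3 := by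
  simp only [weight, List.sum_append, List.sum_cons, List.sum_replicate, smul_eq_mul]
  ring

/-- **Brown's Theorem 1.1 for `ζ(2j+3) ζ({2}^{n-1-j})`, reduced to Zagier's theorem** (Brown 2012,
Theorems 7.3–7.4 at level one, real form). Assume Zagier's Theorem 4.1 in weight `2n + 1`, i.e.
for each of the `n` words `2^{n-1-b} 3 2^{b}` (`b < n`):
`ζ(2^{n-1-b} 3 2^{b}) = 2 ∑_{r=1}^{n} (-1)ʳ (A^r_{n-1-b,b} - B^r_{n-1-b,b}) ζ(2r+1) ζ({2}^{n-r})`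
(written with `r = j + 1`; Zagier 2012, Theorem 1; Brown 2012, Theorem 4.1 — NOT proved in this
tree beyond weight `9`, where it is `Brown2012.zagierFormula_a_b`). Then, the Zagier matrix being
invertible (`Brown2012.isUnit_zagierMatrix`), every product `ζ(2j+3) ζ({2}^{n-1-j})`, `j < n`, is
a rational combination of the Hoffman elements `ζ(2^{a} 3 2^{b})` of weight `2n+1`, hence lies in
`hoffmanSpan (2n+1)`. [cite: Brown2012, Theorems 7.3 and 7.4] -/
theorem multipleZeta_odd_mul_twos_mem_hoffmanSpan_of_zagier (n : ℕ)
    (hZ : ∀ b : ℕ, b < n →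
      multipleZeta (List.replicate b 2 ++ 3 :: List.replicate (n - 1 - b) 2) =
        2 * ∑ r ∈ Finset.range n, (-1 : ℝ) ^ (r + 1) *
          ((zagierA (r + 1) (n - 1 - b) - zagierB (r + 1) b : ℚ) : ℝ) *
            (multipleZeta [2 * r + 3] * multipleZeta (List.replicate (n - 1 - r) 2)))
    (j : ℕ) (hj : j < n) :
    multipleZeta [2 * j + 3] * multipleZeta (List.replicate (n - 1 - j) 2) ∈ hoffmanSpan (2 * n + 1) := by
  -- the system `H = Z⁽ⁿ⁾ • P`
  set P : Fin n → ℝ := fun j => multipleZeta [2 * (j : ℕ) + 3] * multipleZeta (List.replicate (n - 1 - j) 2)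
    with hP
  set H : Fin n → ℝ := fun b => multipleZeta (List.replicate (b : ℕ) 2 ++ 3 :: List.replicate (n - 1 - b) 2)
    with hH
  have hsys : ∀ b : Fin n, H b = ∑ j : Fin n, zagierMatrix n b j • P j := by
    intro b
    rw [hH, hP]
    simp only
    rw [hZ b b.2, Finset.mul_sum, ← Fin.sum_univ_eq_sum_range]
    refine Finset.sum_congr rfl fun j _ => ?_
    rw [zagierMatrix_apply, Rat.smul_def]
    push_cast
    ring
  have hHS : ∀ b : Fin n, H b ∈ hoffmanSpan (2 * n + 1) := by
    intro b
    refine Submodule.subset_span ⟨_, isHoffman_twos_three_twos _ _, ?_, rfl⟩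
    rw [weight_twos_three_twos]
    have := b.2
    omega
  have h := mem_of_isUnit_of_eq_sum_smul (zagierMatrix n) (isUnit_zagierMatrix n) (hoffmanSpan (2 * n + 1))
    P H hsys hHS ⟨j, hj⟩
  simpa [hP] using h

/-- **`ζ(2n+1) ∈ hoffmanSpan (2n+1)` given Zagier's theorem in weight `2n+1`** (`n ≥ 1`): the
case `j = n - 1` of `multipleZeta_odd_mul_twos_mem_hoffmanSpan_of_zagier` — Brown's Theorem 1.1 for
the depth-one value of odd weight, by Brown's own argument at level one (Zagier's theorem,
Corollary 4.4 and the `2`-adic Lemma 7.1), with no motivic input.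
[cite: Brown2012, Theorems 7.3 and 7.4] -/
theorem multipleZeta_odd_mem_hoffmanSpan_of_zagier (n : ℕ) (hn : 1 ≤ n)
    (hZ : ∀ b : ℕ, b < n →
      multipleZeta (List.replicate b 2 ++ 3 :: List.replicate (n - 1 - b) 2) =
        2 * ∑ r ∈ Finset.range n, (-1 : ℝ) ^ (r + 1) *
          ((zagierA (r + 1) (n - 1 - b) - zagierB (r + 1) b : ℚ) : ℝ) *
            (multipleZeta [2 * r + 3] * multipleZeta (List.replicate (n - 1 - r) 2))) :
    multipleZeta [2 * n + 1] ∈ hoffmanSpan (2 * n + 1) := by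
  have h := multipleZeta_odd_mul_twos_mem_hoffmanSpan_of_zagier n hZ (n - 1) (by omega)
  rwa [show 2 * (n - 1) + 3 = 2 * n + 1 by omega, show n - 1 - (n - 1) = 0 by omega,
    List.replicate_zero, multipleZeta_nil, mul_one] at h

/-- The same for `π^{2(n-1-j)} ζ(2j+3)` (`ζ({2}ᵏ) = π^{2k}/(2k+1)!`): given Zagier's theorem in weight
`2n+1`, `π^{2(n-1-j)} ζ(2j+3) ∈ hoffmanSpan (2n+1)` for all `j < n`.
[cite: Brown2012, Theorems 7.3 and 7.4] -/
theorem pi_pow_mul_multipleZeta_odd_mem_hoffmanSpan_of_zagier (n : ℕ)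
    (hZ : ∀ b : ℕ, b < n →
      multipleZeta (List.replicate b 2 ++ 3 :: List.replicate (n - 1 - b) 2) =
        2 * ∑ r ∈ Finset.range n, (-1 : ℝ) ^ (r + 1) *
          ((zagierA (r + 1) (n - 1 - b) - zagierB (r + 1) b : ℚ) : ℝ) *
            (multipleZeta [2 * r + 3] * multipleZeta (List.replicate (n - 1 - r) 2)))
    (j : ℕ) (hj : j < n) :
    π ^ (2 * (n - 1 - j)) * multipleZeta [2 * j + 3] ∈ hoffmanSpan (2 * n + 1) := by
  have h := multipleZeta_odd_mul_twos_mem_hoffmanSpan_of_zagier n hZ j hj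
  rw [multipleZeta_replicate_two] at h
  have hf : ((Nat.factorial (2 * (n - 1 - j) + 1) : ℕ) : ℝ) ≠ 0 := by positivity
  have key : π ^ (2 * (n - 1 - j)) * multipleZeta [2 * j + 3] =
      ((Nat.factorial (2 * (n - 1 - j) + 1) : ℕ) : ℚ) •
        (multipleZeta [2 * j + 3] * (π ^ (2 * (n - 1 - j)) / (Nat.factorial (2 * (n - 1 - j) + 1) : ℝ))) := by
    rw [Rat.smul_def]
    push_cast
    field_simp
  rw [key]
  exact Submodule.smul_mem _ _ h

end Literature.NumberTheory.Transcendental
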